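import Summits.CriticalPhenomena.Ising3DConformalLimit.Theses.MonotoneBlocking
import Summits.CriticalPhenomena.Ising3DConformalLimit.Theorems.HyperoctahedralRPExistsScaleCovariantLimitBlockDefs
import Literature.Probability.LatticeModels.DirInvCorrLength
import Literature.Probability.LatticeModels.SubcriticalFourier
import HarnessLib

/-!
# `MonotoneBlockingTwo` (BM₂, item stmt-CriticalPhenomena-17054): summable rigidity — the inequality is
# FALSE at every subcritical temperature; criticality (`χ = ∞`) is load-bearing

Negative / structural knowledge about the crux
`Summit.CriticalPhenomena.Ising3DConformalLimit.Theses.MonotoneBlocking.MonotoneBlockingTwo` (route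
`MonotoneBlocking`), standing crux disprover, cycle 1 (D-0016). THEOREM-ONLY, no definitions, no notation:
for a kernel `G : ℤ³ → ℝ` write `C_G(L,k) = Σ_{x,y ∈ cube L} G(L•k + x − y)` (the route's `let`-bound `bc`,
verbatim) and `V_G(L) = Σ_{x,y ∈ cube L} G(x − y)`; the BM₂ SHAPE of `G` is
`∀ L ≥ 1, ∀ k, C_G(L,k)·C_G(L+1,0) ≤ C_G(L+1,k)·C_G(L,0)` and its `L = 1` SLICE is
`∀ L ≥ 1, ∀ k, G(k)·V_G(L) ≤ C_G(L,k)·G(0)` (`ρ(L;k) ≥ ρ(1;k)`).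

* `slice_of_shape`: for `G ≥ 0`, `G(0) > 0`, the shape implies the slice (chain the ratios).
* `vol_mul_boxSum_le_of_slice` — THE SPHERE-SUM INEQUALITY: slice + `G ≥ 0` give, for all `L ≥ 1`, `R`,
  `V_G(L)·Σ_{‖k‖∞≤R} G(k) ≤ G(0)·L³·Σ_{‖w‖∞≤LR+L−1} G(w)` (sum the slice over a box; `(k,x) ↦ Lk+x−y` is
  injective, `injOn_blockIndex`).
* `eq_zero_of_summable_slice` — SUMMABLE RIGIDITY: a non-negative summable kernel with `G(0) > 0` satisfies
  the slice (a fortiori the shape) only if it vanishes off the origin (`R → ∞` gives `V_G(L) ≤ G(0)L³`,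
  against one off-diagonal pair, `diag_add_le_vol`).
* `not_shape_twoPointPlus_of_lt_criticalBeta`, `monotoneBlockingTwo_false_without_criticality`: hence the
  crux's inequality transported to ANY `0 < β < β_c(3)` is false (sharpness: `χ(β) < ∞`; Griffiths:
  `⟨σ₀σ_{e₀}⟩⁺_β > 0`). Any proof of the crux must consume `χ(β_c) = ∞`; no all-temperature correlation
  inequality (GKS, GHS, Lebowitz, Simon–Lieb, Messager–Miracle-Solé, FKG, reflection positivity) gives it.
  (Tight: white noise `c·δ₀` and constants DO have the shape — crux directory `Disproof.lean` §C.)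
* Consequences of the crux (the refuter's finite, renormalisation-free tests): `slice_of_monotoneBlockingTwo`,
  `boxSum_bound_of_monotoneBlockingTwo` (`⟨S_L²⟩·Σ_{‖k‖∞≤R}⟨σ₀σ_k⟩ ≤ L³·Σ_{‖w‖∞≤LR+L−1}⟨σ₀σ_w⟩`; its `R → ∞`
  shadow `⟨S_L²⟩ ≤ L^{5−η}(1+o(1))` holds in Monte Carlo with a 37 % margin — not a kill).

References: Aizenman–Barsky–Fernández, J. Stat. Phys. 47 (1987) [AizenmanBarskyFernandez1987]; crux directory
`Cruxes/MonotoneBlockingTwo/{Disproof.lean, STRATEGY-CENSUS.md, NUMERICS-r1-ideator1.md}`.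
-/

noncomputable section

namespace Summit.CriticalPhenomena.Ising3DConformalLimit.MonotoneBlockingTwoNegative

open Literature.Probability.LatticeModels Finset
open scoped BigOperators
open Summit.CriticalPhenomena.Ising3DConformalLimit.Theses.MonotoneBlocking (MonotoneBlockingTwo)
open Summit.CriticalPhenomena.Ising3DConformalLimit.Cruxes.ExistsScaleCovariantLimit.MonotoneBlockingPort
  (cube mem_cube card_cube cube_zero)

/-! ### The block `cube L = [0,L)³` -/

/-- `cube 1 = {0}`. [folklore] -/
theorem cube_one : cube 1 = {0} := by
  have : (Finset.Ico (0:ℤ) ((1:ℕ):ℤ)) = {0} := by decide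
  rw [cube]; simp only [this]; exact Fintype.piFinset_singleton (fun _ : Fin 3 => (0:ℤ))

/-- The route's `C(L,0)` (offset `L•0 +`) is the block variance `V(L) = Σ G(x−y)`. [folklore] -/
theorem blockSum_zero_offset (G : Site 3 → ℝ) (L : ℕ) :
    (∑ x ∈ cube L, ∑ y ∈ cube L, G ((L:ℤ) • (0 : Site 3) + x - y)) =
      ∑ x ∈ cube L, ∑ y ∈ cube L, G (x - y) := by
  simp

/-- `V_G(L) ≥ L³·G(0)` for `G ≥ 0` (diagonal pairs). [folklore] -/
theorem card_mul_le_vol {G : Site 3 → ℝ} (hG : ∀ z, 0 ≤ G z) (L : ℕ) :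
    (L:ℝ) ^ 3 * G 0 ≤ ∑ x ∈ cube L, ∑ y ∈ cube L, G (x - y) := by
  have h : ∀ x ∈ cube L, G 0 ≤ ∑ y ∈ cube L, G (x - y) := by
    intro x hx
    have := Finset.single_le_sum (f := fun y => G (x - y)) (fun y _ => hG _) hx
    simpa using this
  calc (L:ℝ) ^ 3 * G 0 = ∑ x ∈ cube L, G 0 := by
        rw [Finset.sum_const, card_cube, nsmul_eq_mul]; push_cast; ring
    _ ≤ _ := Finset.sum_le_sum h

/-- Block sums of a non-negative kernel are non-negative. [folklore] -/
theorem blockSum_nonneg {G : Site 3 → ℝ} (hG : ∀ z, 0 ≤ G z) (L : ℕ) (k : Site 3) :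
    0 ≤ ∑ x ∈ cube L, ∑ y ∈ cube L, G ((L:ℤ) • k + x - y) :=
  Finset.sum_nonneg fun _ _ => Finset.sum_nonneg fun _ _ => hG _

/-- `V_G(L) > 0` for `L ≥ 1` when `G ≥ 0` and `G(0) > 0`. [folklore] -/
theorem vol_pos {G : Site 3 → ℝ} (hG : ∀ z, 0 ≤ G z) (h0 : 0 < G 0) {L : ℕ} (hL : 1 ≤ L) :
    0 < ∑ x ∈ cube L, ∑ y ∈ cube L, G (x - y) :=
  lt_of_lt_of_le (by positivity) (card_mul_le_vol hG L)

/-! ### The shape chains to the slice -/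

/-- **The `L = 1` slice from the BM₂ shape**: for `G ≥ 0` with `G(0) > 0`, the shape
`C(L,k)·C(L+1,0) ≤ C(L+1,k)·C(L,0)` (all `L ≥ 1`, `k`) chains down to `G(k)·V(L) ≤ C(L,k)·G(0)`, i.e.
`ρ(L;k) ≥ ρ(1;k) = G(k)/G(0)`. [folklore] -/
theorem slice_of_shape {G : Site 3 → ℝ} (hG : ∀ z, 0 ≤ G z) (h0 : 0 < G 0)
    (h : ∀ L : ℕ, 1 ≤ L → ∀ k : Site 3,
      (∑ x ∈ cube L, ∑ y ∈ cube L, G ((L:ℤ) • k + x - y)) *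
          (∑ x ∈ cube (L + 1), ∑ y ∈ cube (L + 1), G (((L + 1 : ℕ) : ℤ) • (0 : Site 3) + x - y)) ≤
        (∑ x ∈ cube (L + 1), ∑ y ∈ cube (L + 1), G (((L + 1 : ℕ) : ℤ) • k + x - y)) *
          (∑ x ∈ cube L, ∑ y ∈ cube L, G ((L:ℤ) • (0 : Site 3) + x - y)))
    {L : ℕ} (hL : 1 ≤ L) (k : Site 3) :
    G k * (∑ x ∈ cube L, ∑ y ∈ cube L, G (x - y)) ≤
      (∑ x ∈ cube L, ∑ y ∈ cube L, G ((L:ℤ) • k + x - y)) * G 0 := by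
  induction L, hL using Nat.le_induction with
  | base => simp [cube_one]
  | succ L hL ih =>
    have hstep := h L hL k
    rw [blockSum_zero_offset, blockSum_zero_offset] at hstep
    set V := ∑ x ∈ cube L, ∑ y ∈ cube L, G (x - y)
    set V' := ∑ x ∈ cube (L + 1), ∑ y ∈ cube (L + 1), G (x - y)
    set C := ∑ x ∈ cube L, ∑ y ∈ cube L, G ((L:ℤ) • k + x - y)
    set C' := ∑ x ∈ cube (L + 1), ∑ y ∈ cube (L + 1), G (((L + 1 : ℕ) : ℤ) • k + x - y)
    have hV : 0 < V := vol_pos hG h0 hL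
    have hV' : 0 ≤ V' := (vol_pos hG h0 (by omega : 1 ≤ L + 1)).le
    have h1 : G k * V * V' ≤ C * G 0 * V' := mul_le_mul_of_nonneg_right ih hV'
    have h2 : C * G 0 * V' ≤ G 0 * (C' * V) := by
      have := mul_le_mul_of_nonneg_left hstep h0.le
      linarith [this]
    have h3 : (G k * V') * V ≤ (C' * G 0) * V := by nlinarith [h1, h2]
    exact le_of_mul_le_mul_right h3 hV

/-! ### The sphere-sum inequality -/

/-- Injectivity of `(k, x) ↦ L•k + x − y` on `ℤ³ × cube L`. [folklore] -/
theorem injOn_blockIndex (L : ℕ) (y : Site 3) :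
    Set.InjOn (fun p : Site 3 × Site 3 => (L:ℤ) • p.1 + p.2 - y)
      ((Set.univ : Set (Site 3)) ×ˢ (cube L : Set (Site 3))) := by
  rintro ⟨k, x⟩ ⟨-, hx⟩ ⟨k', x'⟩ ⟨-, hx'⟩ hEq
  simp only [Finset.mem_coe, mem_cube] at hx hx'
  simp only at hEq
  have hc : ∀ i, (L:ℤ) * k i + x i = (L:ℤ) * k' i + x' i := by
    intro i
    have := congr_fun hEq i
    simp only [Pi.sub_apply, Pi.add_apply, Pi.smul_apply, smul_eq_mul] at this
    linarith
  have hk : k = k' := by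
    funext i
    have h := hc i
    obtain ⟨hx0, hxL⟩ := hx i
    obtain ⟨hx0', hxL'⟩ := hx' i
    have hL0 : (0:ℤ) < L := by omega
    have h1 : k i - k' i < 1 := lt_of_mul_lt_mul_left (by linarith) hL0.le
    have h2 : -1 < k i - k' i := lt_of_mul_lt_mul_left (by linarith) hL0.le
    omega
  subst hk
  have hx'' : x = x' := by
    funext i; have := hc i; linarith
  subst hx''
  rfl

/-- **The sphere-sum inequality** (finite, constant-free): if `G ≥ 0`, `G(0) > 0` and `G` satisfies the
slice, then for all `L ≥ 1` and `R`, `V_G(L) · Σ_{‖k‖∞ ≤ R} G(k) ≤ G(0) · L³ · Σ_{‖w‖∞ ≤ LR+L−1} G(w)`.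
With `Σ_{‖w‖∞≤R} G ≈ c R^{2−η}` this reads `V(L) ≲ G(0) L^{5−η}`. [folklore] -/
theorem vol_mul_boxSum_le_of_slice {G : Site 3 → ℝ} (hG : ∀ z, 0 ≤ G z) (h0 : 0 < G 0)
    (hsl : ∀ L : ℕ, 1 ≤ L → ∀ k : Site 3, G k * (∑ x ∈ cube L, ∑ y ∈ cube L, G (x - y)) ≤
      (∑ x ∈ cube L, ∑ y ∈ cube L, G ((L:ℤ) • k + x - y)) * G 0)
    {L : ℕ} (hL : 1 ≤ L) (R : ℕ) :
    (∑ x ∈ cube L, ∑ y ∈ cube L, G (x - y)) * ∑ k ∈ box 3 R, G k ≤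
      G 0 * (L:ℝ) ^ 3 * ∑ w ∈ box 3 (L * R + (L - 1)), G w := by
  set V := ∑ x ∈ cube L, ∑ y ∈ cube L, G (x - y)
  have hslice : V * ∑ k ∈ box 3 R, G k ≤
      G 0 * ∑ k ∈ box 3 R, ∑ x ∈ cube L, ∑ y ∈ cube L, G ((L:ℤ) • k + x - y) := by
    rw [Finset.mul_sum, Finset.mul_sum]
    refine Finset.sum_le_sum fun k _ => ?_
    have := hsl L hL k
    linarith
  refine hslice.trans ?_
  rw [mul_assoc]
  refine mul_le_mul_of_nonneg_left ?_ h0.le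
  have hswap : ∑ k ∈ box 3 R, ∑ x ∈ cube L, ∑ y ∈ cube L, G ((L:ℤ) • k + x - y) =
      ∑ y ∈ cube L, ∑ p ∈ box 3 R ×ˢ cube L, G ((L:ℤ) • p.1 + p.2 - y) := by
    calc ∑ k ∈ box 3 R, ∑ x ∈ cube L, ∑ y ∈ cube L, G ((L:ℤ) • k + x - y)
        = ∑ k ∈ box 3 R, ∑ y ∈ cube L, ∑ x ∈ cube L, G ((L:ℤ) • k + x - y) :=
          Finset.sum_congr rfl fun k _ => Finset.sum_comm
      _ = ∑ y ∈ cube L, ∑ k ∈ box 3 R, ∑ x ∈ cube L, G ((L:ℤ) • k + x - y) := Finset.sum_comm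
      _ = _ := by
          refine Finset.sum_congr rfl fun y _ => ?_
          rw [Finset.sum_product]
  rw [hswap]
  have hL1 : ((L - 1 : ℕ) : ℤ) = (L:ℤ) - 1 := by push_cast [Nat.cast_sub hL]; ring
  have hinner : ∀ y ∈ cube L, ∑ p ∈ box 3 R ×ˢ cube L, G ((L:ℤ) • p.1 + p.2 - y)
      ≤ ∑ w ∈ box 3 (L * R + (L - 1)), G w := by
    intro y hy
    have hinj : Set.InjOn (fun p : Site 3 × Site 3 => (L:ℤ) • p.1 + p.2 - y)
        ↑(box 3 R ×ˢ cube L) := fun p hp q hq hpq =>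
      injOn_blockIndex L y ⟨trivial, (Finset.mem_product.1 hp).2⟩
        ⟨trivial, (Finset.mem_product.1 hq).2⟩ hpq
    rw [← Finset.sum_image (f := G) hinj]
    refine Finset.sum_le_sum_of_subset_of_nonneg ?_ (fun w _ _ => hG w)
    intro w hw
    rw [Finset.mem_image] at hw
    obtain ⟨⟨k, x⟩, hp, rfl⟩ := hw
    rw [Finset.mem_product] at hp
    obtain ⟨hk, hx⟩ := hp
    rw [mem_box] at hk
    rw [mem_cube] at hx hy
    rw [mem_box]
    intro i
    obtain ⟨hk1, hk2⟩ := hk i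
    obtain ⟨hx1, hx2⟩ := hx i
    obtain ⟨hy1, hy2⟩ := hy i
    have hL0 : (0:ℤ) ≤ L := by positivity
    have hm1 : (L:ℤ) * k i ≤ L * R := mul_le_mul_of_nonneg_left hk2 hL0
    have hm2 : (L:ℤ) * (-(R:ℤ)) ≤ L * k i := mul_le_mul_of_nonneg_left hk1 hL0
    simp only [Pi.sub_apply, Pi.add_apply, Pi.smul_apply, smul_eq_mul, Nat.cast_add, Nat.cast_mul, hL1]
    constructor <;> nlinarith
  calc ∑ y ∈ cube L, ∑ p ∈ box 3 R ×ˢ cube L, G ((L:ℤ) • p.1 + p.2 - y)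
      ≤ ∑ y ∈ cube L, ∑ w ∈ box 3 (L * R + (L - 1)), G w := Finset.sum_le_sum hinner
    _ = (L:ℝ) ^ 3 * ∑ w ∈ box 3 (L * R + (L - 1)), G w := by
        rw [Finset.sum_const, card_cube, nsmul_eq_mul]; push_cast; ring

/-! ### Summable rigidity -/

/-- **Summable rigidity, step 1**: if `G ≥ 0` is summable with `G(0) > 0` and satisfies the slice, then
`V_G(L) ≤ G(0)·L³` for every `L ≥ 1` (`R → ∞` in the sphere-sum inequality). [folklore] -/
theorem vol_le_of_summable_slice {G : Site 3 → ℝ} (hG : ∀ z, 0 ≤ G z) (h0 : 0 < G 0) (hs : Summable G)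
    (hsl : ∀ L : ℕ, 1 ≤ L → ∀ k : Site 3, G k * (∑ x ∈ cube L, ∑ y ∈ cube L, G (x - y)) ≤
      (∑ x ∈ cube L, ∑ y ∈ cube L, G ((L:ℤ) • k + x - y)) * G 0)
    {L : ℕ} (hL : 1 ≤ L) :
    (∑ x ∈ cube L, ∑ y ∈ cube L, G (x - y)) ≤ G 0 * (L:ℝ) ^ 3 := by
  set V := ∑ x ∈ cube L, ∑ y ∈ cube L, G (x - y)
  set χ : ℝ := ∑' z, G z with hχ
  have hχpos : 0 < χ := lt_of_lt_of_le h0 (hs.le_tsum 0 fun j _ => hG j)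
  have hbound : ∀ R : ℕ, V * ∑ k ∈ box 3 R, G k ≤ G 0 * (L:ℝ) ^ 3 * χ := fun R =>
    (vol_mul_boxSum_le_of_slice hG h0 hsl hL R).trans
      (mul_le_mul_of_nonneg_left (hs.sum_le_tsum _ fun w _ => hG w) (by positivity))
  have hχle : V * χ ≤ G 0 * (L:ℝ) ^ 3 * χ := by
    rw [hχ, ← tsum_mul_left]
    refine (hs.mul_left _).tsum_le_of_sum_le fun s => ?_
    obtain ⟨R, hR⟩ := exists_forall_subset_box 3 s
    calc ∑ i ∈ s, V * G i = V * ∑ i ∈ s, G i := by rw [Finset.mul_sum]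
      _ ≤ V * ∑ k ∈ box 3 R, G k :=
          mul_le_mul_of_nonneg_left
            (Finset.sum_le_sum_of_subset_of_nonneg (hR R le_rfl) fun w _ _ => hG w)
            (vol_pos hG h0 hL).le
      _ ≤ G 0 * (L:ℝ) ^ 3 * χ := hbound R
  exact le_of_mul_le_mul_right hχle hχpos

/-- The block variance exceeds its diagonal part by (at least) any single off-diagonal value: for `z ≠ 0`
with all `|zᵢ| ≤ L₀`, `(L₀+1)³·G(0) + G(z) ≤ V_G(L₀+1)`. [folklore] -/
theorem diag_add_le_vol {G : Site 3 → ℝ} (hG : ∀ z, 0 ≤ G z) {L₀ : ℕ} {z : Site 3}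
    (hz : z ≠ 0) (hzb : z ∈ box 3 L₀) :
    ((L₀ + 1 : ℕ) : ℝ) ^ 3 * G 0 + G z ≤ ∑ x ∈ cube (L₀ + 1), ∑ y ∈ cube (L₀ + 1), G (x - y) := by
  rw [mem_box] at hzb
  set L := L₀ + 1 with hLdef
  let x₀ : Site 3 := fun i => max (z i) 0
  let y₀ : Site 3 := fun i => max (-(z i)) 0
  have hx₀ : x₀ ∈ cube L := by
    rw [mem_cube]; intro i; obtain ⟨h1, h2⟩ := hzb i
    refine ⟨le_max_right _ _, ?_⟩
    simp only [x₀, hLdef, Nat.cast_add, Nat.cast_one, max_lt_iff]; omega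
  have hy₀ : y₀ ∈ cube L := by
    rw [mem_cube]; intro i; obtain ⟨h1, h2⟩ := hzb i
    refine ⟨le_max_right _ _, ?_⟩
    simp only [y₀, hLdef, Nat.cast_add, Nat.cast_one, max_lt_iff]; omega
  have hxy : x₀ - y₀ = z := by
    funext i; simp only [x₀, y₀, Pi.sub_apply]
    rcases le_total (z i) 0 with h | h
    · rw [max_eq_right h, max_eq_left (by linarith)]; ring
    · rw [max_eq_left h, max_eq_right (by linarith)]; ring
  have hne : x₀ ≠ y₀ := by
    intro hEq; apply hz; rw [← hxy, hEq, sub_self]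
  have hrow : ∀ x ∈ cube L, G 0 + (if x = x₀ then G z else 0) ≤ ∑ y ∈ cube L, G (x - y) := by
    intro x hx
    by_cases hxx : x = x₀
    · subst hxx
      rw [if_pos rfl]
      have hsub : ({x₀, y₀} : Finset (Site 3)) ⊆ cube L := by
        intro w hw
        rcases Finset.mem_insert.1 hw with rfl | hw
        · exact hx
        · rw [Finset.mem_singleton.1 hw]; exact hy₀
      refine le_trans ?_ (Finset.sum_le_sum_of_subset_of_nonneg hsub fun w _ _ => hG _)
      rw [Finset.sum_pair hne]
      simp [hxy]
    · rw [if_neg hxx, add_zero]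
      have := Finset.single_le_sum (f := fun y => G (x - y)) (fun y _ => hG _) hx
      simpa using this
  calc ((L:ℕ) : ℝ) ^ 3 * G 0 + G z
      = ∑ x ∈ cube L, (G 0 + if x = x₀ then G z else 0) := by
        rw [Finset.sum_add_distrib, Finset.sum_const, card_cube, nsmul_eq_mul,
          Finset.sum_ite_eq' (cube L) x₀, if_pos hx₀]
        push_cast; ring
    _ ≤ _ := Finset.sum_le_sum hrow

/-- **SUMMABLE RIGIDITY.** A non-negative SUMMABLE kernel with `G(0) > 0` satisfies the slice (a fortiori
the BM₂ shape) only if it vanishes off the origin: BM₂ + finite susceptibility ⟹ white noise. So any proof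
of the crux must consume `χ(β_c) = ∞`; no inequality valid at all temperatures proves BM₂ on its own.
[folklore] -/
theorem eq_zero_of_summable_slice {G : Site 3 → ℝ} (hG : ∀ z, 0 ≤ G z) (h0 : 0 < G 0) (hs : Summable G)
    (hsl : ∀ L : ℕ, 1 ≤ L → ∀ k : Site 3, G k * (∑ x ∈ cube L, ∑ y ∈ cube L, G (x - y)) ≤
      (∑ x ∈ cube L, ∑ y ∈ cube L, G ((L:ℤ) • k + x - y)) * G 0)
    {z : Site 3} (hz : z ≠ 0) : G z = 0 := by
  obtain ⟨L₀, hL₀⟩ := exists_forall_subset_box 3 ({z} : Finset (Site 3))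
  have hzb : z ∈ box 3 L₀ := hL₀ L₀ le_rfl (Finset.mem_singleton_self z)
  have hlow := diag_add_le_vol hG hz hzb
  have hup := vol_le_of_summable_slice hG h0 hs hsl (L := L₀ + 1) (by omega)
  have : G z ≤ 0 := by push_cast at hlow hup; nlinarith
  exact le_antisymm this (hG z)

/-! ### The crux transported below `β_c` is false -/

/-- The first lattice direction `e₀ ≠ 0`. [folklore] -/
theorem single_ne_zero' : (Pi.single 0 1 : Site 3) ≠ 0 := fun h => by simpa using congr_fun h 0

/-- **The crux's inequality is FALSE at every subcritical temperature** `0 < β < β_c(3)`: writing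
`C_β(L,k) = Σ_{x,y∈cube L}⟨σ₀σ_{Lk+x−y}⟩⁺_β`, the BM₂ shape `C_β(L,k)C_β(L+1,0) ≤ C_β(L+1,k)C_β(L,0)` (all
`L ≥ 1`, `k`) fails — the susceptibility is finite (sharpness) while `⟨σ₀σ_{e₀}⟩⁺_β > 0` (Griffiths).
Criticality is load-bearing in the model itself, not only in toys. [cite: AizenmanBarskyFernandez1987, Thm. 1] -/
theorem not_shape_twoPointPlus_of_lt_criticalBeta {β : ℝ} (hβ : 0 < β) (hβc : β < criticalBeta 3) :
    ¬ ∀ L : ℕ, 1 ≤ L → ∀ k : Site 3,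
      (∑ x ∈ cube L, ∑ y ∈ cube L, twoPointPlus 3 β ((L:ℤ) • k + x - y)) *
          (∑ x ∈ cube (L + 1), ∑ y ∈ cube (L + 1),
            twoPointPlus 3 β (((L + 1 : ℕ) : ℤ) • (0 : Site 3) + x - y)) ≤
        (∑ x ∈ cube (L + 1), ∑ y ∈ cube (L + 1), twoPointPlus 3 β (((L + 1 : ℕ) : ℤ) • k + x - y)) *
          (∑ x ∈ cube L, ∑ y ∈ cube L, twoPointPlus 3 β ((L:ℤ) • (0 : Site 3) + x - y)) := by
  intro h
  have hG : ∀ z, 0 ≤ twoPointPlus 3 β z := fun z => twoPointPlus_nonneg_of_gks hβ.le z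
  have h0 : 0 < twoPointPlus 3 β 0 := by rw [twoPointPlus_zero]; exact one_pos
  have hs := summable_twoPointPlus_of_lt_criticalBeta (d := 3) (by norm_num) hβ.le hβc
  have hz := eq_zero_of_summable_slice hG h0 hs (fun L hL k => slice_of_shape hG h0 h hL k) single_ne_zero'
  exact (twoPointPlus_pos hβ _).ne' hz

/-- **`MonotoneBlockingTwo` without criticality is false**: there is NO `0 < β < β_c(3)` at which the
plus-state two-point function blocks monotonically (the crux is exactly this inequality at `β = β_c(3)`:
`criticalTwoPoint 3 = twoPointPlus 3 (criticalBeta 3)`, `monotoneBlockingTwo_iff_shape_criticalBeta`).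
[folklore] -/
theorem monotoneBlockingTwo_false_without_criticality :
    ¬ ∃ β : ℝ, 0 < β ∧ β < criticalBeta 3 ∧ ∀ L : ℕ, 1 ≤ L → ∀ k : Site 3,
      (∑ x ∈ cube L, ∑ y ∈ cube L, twoPointPlus 3 β ((L:ℤ) • k + x - y)) *
          (∑ x ∈ cube (L + 1), ∑ y ∈ cube (L + 1),
            twoPointPlus 3 β (((L + 1 : ℕ) : ℤ) • (0 : Site 3) + x - y)) ≤
        (∑ x ∈ cube (L + 1), ∑ y ∈ cube (L + 1), twoPointPlus 3 β (((L + 1 : ℕ) : ℤ) • k + x - y)) *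
          (∑ x ∈ cube L, ∑ y ∈ cube L, twoPointPlus 3 β ((L:ℤ) • (0 : Site 3) + x - y)) :=
  fun ⟨_, hβ, hβc, h⟩ => not_shape_twoPointPlus_of_lt_criticalBeta hβ hβc h

/-- The crux is the same shape at `β = β_c(3)` (definitional). [folklore] -/
theorem monotoneBlockingTwo_iff_shape_criticalBeta :
    MonotoneBlockingTwo ↔ ∀ L : ℕ, 1 ≤ L → ∀ k : Site 3,
      (∑ x ∈ cube L, ∑ y ∈ cube L, twoPointPlus 3 (criticalBeta 3) ((L:ℤ) • k + x - y)) *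
          (∑ x ∈ cube (L + 1), ∑ y ∈ cube (L + 1),
            twoPointPlus 3 (criticalBeta 3) (((L + 1 : ℕ) : ℤ) • (0 : Site 3) + x - y)) ≤
        (∑ x ∈ cube (L + 1), ∑ y ∈ cube (L + 1),
            twoPointPlus 3 (criticalBeta 3) (((L + 1 : ℕ) : ℤ) • k + x - y)) *
          (∑ x ∈ cube L, ∑ y ∈ cube L, twoPointPlus 3 (criticalBeta 3) ((L:ℤ) • (0 : Site 3) + x - y)) :=
  Iff.rfl

/-! ### Consequences of the crux for the critical state (finite, renormalisation-free) -/

/-- **BM₂ ⟹ the `L = 1` slice** `⟨σ₀σ_k⟩·⟨S_L²⟩ ≤ ⟨S_L(0)S_L(Lk)⟩` for all `L ≥ 1`, `k ∈ ℤ³` (at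
`k = e₀`: `ρ(L;e₀) ≥ ⟨σ₀σ_{e₀}⟩_{β_c} ≈ 0.33` for every `L`; at `|k| → ∞`: two-scale doubling with the
sharp constant). [folklore] -/
theorem slice_of_monotoneBlockingTwo (h : MonotoneBlockingTwo) {L : ℕ} (hL : 1 ≤ L) (k : Site 3) :
    criticalTwoPoint 3 k * (∑ x ∈ cube L, ∑ y ∈ cube L, criticalTwoPoint 3 (x - y)) ≤
      ∑ x ∈ cube L, ∑ y ∈ cube L, criticalTwoPoint 3 ((L:ℤ) • k + x - y) := by
  have := slice_of_shape criticalTwoPoint_nonneg' (by rw [criticalTwoPoint_zero']; exact one_pos) h hL k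
  simpa [criticalTwoPoint_zero'] using this

/-- **BM₂ ⟹ THE SPHERE-SUM INEQUALITY for the critical state**: for all `L ≥ 1`, `R ≥ 0`,
`⟨S_L²⟩_{β_c} · Σ_{‖k‖∞ ≤ R} ⟨σ₀σ_k⟩_{β_c} ≤ L³ · Σ_{‖w‖∞ ≤ LR+L−1} ⟨σ₀σ_w⟩_{β_c}`. Its `R → ∞` shadow
(with `Σ_{‖w‖∞≤R}⟨σ₀σ_w⟩ ∼ cR^{2−η}`) is `⟨S_L²⟩ ≤ L^{5−η}(1+o(1))` uniformly from `L = 1`, i.e.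
`A·K_{1+η}(0) ≤ 1` for the two-point amplitude `A ≈ 0.33` and the self-cell integral
`K_{1.036}(0) = 1.9376`: `0.63 < 1`, a 37 % margin in Monte Carlo — not a kill. [folklore] -/
theorem boxSum_bound_of_monotoneBlockingTwo (h : MonotoneBlockingTwo) {L : ℕ} (hL : 1 ≤ L) (R : ℕ) :
    (∑ x ∈ cube L, ∑ y ∈ cube L, criticalTwoPoint 3 (x - y)) * ∑ k ∈ box 3 R, criticalTwoPoint 3 k ≤
      (L:ℝ) ^ 3 * ∑ w ∈ box 3 (L * R + (L - 1)), criticalTwoPoint 3 w := by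
  have h1 : (0:ℝ) < criticalTwoPoint 3 0 := by rw [criticalTwoPoint_zero']; exact one_pos
  have := vol_mul_boxSum_le_of_slice criticalTwoPoint_nonneg' h1
    (fun L hL k => slice_of_shape criticalTwoPoint_nonneg' h1 h hL k) hL R
  simpa [criticalTwoPoint_zero'] using this

end Summit.CriticalPhenomena.Ising3DConformalLimit.MonotoneBlockingTwoNegative

end
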